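import Summits.CriticalPhenomena.PercolationContinuityZ3.Theorems.Transplant.SkelNegBParamsFaceRun
import HarnessLib

/-!
# N1 params, chain of record `NegB`, part FaceRun-A — the (ζ′) twin of part FaceRun §1–§2: the tangential start half-widths at the (ζ′) run counts
# `N_r + 1 ≤ 1000·Kq` — **`KS.qB3XA R′ := W + 1000·Kq·R′ + 2`**, **`KS.qB3YA R′ := 2n_L + 1000·Kq·R′`** with **`hq₃X_RA/hq₃Y_RA`**, and the cross-link
# fit **`hfitX_RA`** (`qB + (N_r+1)·R′ ≤ n_L` from `4qB ≤ n_L`, `R′ ≤ RA′`, `N_r + 1 ≤ 1000·Kq` and the (ζ′) floor `2000·Kq·(RA′+2) ≤ n_L`, a hypothesis —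
# `KS.nL_floorsA.1` at `fT 0 fxA`); §3 of part FaceRun (`xBoxLoA_mono`, `R'_le_nL`, `hclrX_s/d/t`) is cell-free and reused.  (stmt-g16 2026-08-22; (ζ′).)
builds on p205010 (kernel theorem, internal audit signed; external expert review pending) — nothing in this file uses p205010; NOTHING is claimed about
the node `SamePDropOfSkeletonNeg₁` (OPEN).
Lane `prim-bschramm-*`, seat `prim-bschramm-stmt` (gen 16); helper file (`--supports stmt-CriticalPhenomena-4575 --as helper`); ledger HOME/prim-bschramm-stmt/NEG-PARAMS.md.
[cite: KozmaNitzan2024, §4 Lemma 11 (p. 22), p. 28] [cite: MartineauTassion2017, §4.3 Lemma 4.2]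
-/

noncomputable section

open scoped Classical

namespace Summit.CriticalPhenomena.PercolationContinuityZ3.Theorems.Transplant

namespace PlanarSkeletonNeg

namespace NegB

open Literature.Probability.Percolation Literature.Probability.LatticeModels SimpleGraph
open SkelConc (Consts)
open Skelφ (shearUnit shearUnit_pos)
open Skelφ.StepI (DataN)
open Neg

namespace KS

section Q3

variable (κ : Consts) {V : Type} [DecidableEq V] [Countable V] {G : SimpleGraph V} [G.LocallyFinite] (Φ : PlanarSkeletonNeg G) (t : V)
  (p : unitInterval) (D : DataN V) (g f : ℕ)

/-- **The x-face's tangential (y′-run) start half-width of the (ζ′) chain** `qB3XA R′ := W + 1000·Kq·R′ + 2`. [this work] -/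
def qB3XA (R' : ℕ) : ℕ := Wrun κ Φ t p D g f + 1000 * Neg.Kq κ * R' + 2

/-- **The y′-face's tangential (x-run) start half-width of the (ζ′) chain** `qB3YA R′ := 2n_L + 1000·Kq·R′`. [this work] -/
def qB3YA (R' : ℕ) : ℕ := 2 * nL κ Φ t p D g f + 1000 * Neg.Kq κ * R'

/-- **`hq₃` (x-face, (ζ′))**: `W + (N_r+1)·R′ + 2 ≤ qB3XA R′` whenever `N_r + 1 ≤ 1000·Kq`. [folklore] -/
theorem hq₃X_RA (R' : ℕ) {Nr : ℕ} (hNr : Nr + 1 ≤ 1000 * Neg.Kq κ) :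
    ((nL κ Φ t p D g f * ℓL κ Φ t p D g f / shearUnit (nL κ Φ t p D g f) (hL κ Φ t p D g f) + 1 : ℕ) : ℤ) + ((Nr : ℤ) + 1) * R' + 2 ≤
      (qB3XA κ Φ t p D g f R' : ℤ) := by
  unfold qB3XA Wrun
  have h : ((Nr : ℤ) + 1) * R' ≤ 1000 * (Neg.Kq κ : ℤ) * (R' : ℤ) := by
    have : ((Nr : ℤ) + 1) ≤ ((1000 * Neg.Kq κ : ℕ) : ℤ) := by exact_mod_cast hNr
    push_cast at this
    exact mul_le_mul_of_nonneg_right this (by positivity)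
  push_cast; linarith

/-- **`hq₃` (y′-face, (ζ′))**: `2n_L + (N_r+1)·R′ ≤ qB3YA R′` whenever `N_r + 1 ≤ 1000·Kq`. [folklore] -/
theorem hq₃Y_RA (R' : ℕ) {Nr : ℕ} (hNr : Nr + 1 ≤ 1000 * Neg.Kq κ) :
    2 * (nL κ Φ t p D g f : ℤ) + ((Nr : ℤ) + 1) * R' ≤ (qB3YA κ Φ t p D g f R' : ℤ) := by
  unfold qB3YA
  have h : ((Nr : ℤ) + 1) * R' ≤ 1000 * (Neg.Kq κ : ℤ) * (R' : ℤ) := by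
    have : ((Nr : ℤ) + 1) ≤ ((1000 * Neg.Kq κ : ℕ) : ℤ) := by exact_mod_cast hNr
    push_cast at this
    exact mul_le_mul_of_nonneg_right this (by positivity)
  push_cast; linarith

end Q3

section Fit

variable (κ : Consts) {V : Type} [DecidableEq V] [Countable V] {G : SimpleGraph V} [G.LocallyFinite] (Φ : PlanarSkeletonNeg G) (t : V)
  (p : unitInterval) (D : DataN V) (g f mk : ℕ)

/-- **`hfit` ((ζ′))**: `qB + (N_r+1)·R′ ≤ n_L` for every start half-width with `4qB ≤ n_L`, every `R′ ≤ RA′` and `N_r + 1 ≤ 1000·Kq`, given the (ζ′) floor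
`2000·Kq·(RA′+2) ≤ n_L` (`KS.nL_floorsA.1` at `f := fT 0 fxA`). [folklore] -/
theorem hfitX_RA {qB R' Nr : ℕ} (hq : 4 * qB ≤ nL κ Φ t p D g f) (hR : R' ≤ RA' κ Φ t p D mk) (hNr : Nr + 1 ≤ 1000 * Neg.Kq κ)
    (hnA : 2000 * Neg.Kq κ * (RA' κ Φ t p D mk + 2) ≤ nL κ Φ t p D g f) :
    (qB : ℤ) + ((Nr : ℤ) + 1) * R' ≤ (nL κ Φ t p D g f : ℤ) := by
  have hn : 2000 * (Neg.Kq κ : ℤ) * ((RA' κ Φ t p D mk : ℤ) + 2) ≤ (nL κ Φ t p D g f : ℤ) := by exact_mod_cast hnA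
  have a : ((Nr : ℤ) + 1) ≤ 1000 * (Neg.Kq κ : ℤ) := by
    have : ((Nr : ℤ) + 1) ≤ ((1000 * Neg.Kq κ : ℕ) : ℤ) := by exact_mod_cast hNr
    push_cast at this; exact this
  clear hNr hnA
  have hq0 : (0 : ℤ) ≤ (Neg.Kq κ : ℤ) := Nat.cast_nonneg _
  have hR0 : (0 : ℤ) ≤ (RA' κ Φ t p D mk : ℤ) := Nat.cast_nonneg _
  have b : (R' : ℤ) ≤ RA' κ Φ t p D mk := by exact_mod_cast hR
  have h1 : ((Nr : ℤ) + 1) * R' ≤ 1000 * (Neg.Kq κ : ℤ) * (RA' κ Φ t p D mk : ℤ) :=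
    calc ((Nr : ℤ) + 1) * R' ≤ (1000 * (Neg.Kq κ : ℤ)) * (R' : ℤ) := mul_le_mul_of_nonneg_right a (by positivity)
      _ ≤ (1000 * (Neg.Kq κ : ℤ)) * (RA' κ Φ t p D mk : ℤ) := mul_le_mul_of_nonneg_left b (by positivity)
  have hq' : 4 * (qB : ℤ) ≤ nL κ Φ t p D g f := by exact_mod_cast hq
  have hKR : (0 : ℤ) ≤ (Neg.Kq κ : ℤ) * (RA' κ Φ t p D mk : ℤ) := mul_nonneg hq0 hR0
  linarith

end Fit

end KS

end NegB

end PlanarSkeletonNeg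

end Summit.CriticalPhenomena.PercolationContinuityZ3.Theorems.Transplant

end
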